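import Summits.Parity.GeneralizedHardyLittlewood.Theorems.FordMaynardNoSieveConst0164NegWitness0164FamiliesA
import Summits.Parity.GeneralizedHardyLittlewood.Theorems.FordMaynardNoSieveConst0164NegWitness0164FamiliesB
import Summits.Parity.GeneralizedHardyLittlewood.Theorems.FordMaynardNoSieveConst0164NegWitness0164FamiliesC
import Summits.Parity.GeneralizedHardyLittlewood.Theorems.FordMaynardNoSieveConst0164NegWitness0164CruxOfFamilies
import Summits.Parity.GeneralizedHardyLittlewood.Theorems.FordMaynardNoSieveConst0164NegWitness0164FamilySwap
import Summits.Parity.GeneralizedHardyLittlewood.Theses.FordMaynardNoSieveConst0164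

/-!
# Route `FordMaynardNoSieveConst0164`, crux `NegWitness0164` (stmt-Parity-19102) — CLOSED: the registered stub
# `stub_tweakNeg0164` and the route crux `NegWitness0164` by name

K. Ford, J. Maynard, *On the theory of prime producing sieves*, arXiv:2407.14368, Theorem 2.7 (c) at `ν₀ = 41/250`:
there is `f ∈ 𝔉*_η(γ)`, `η = 41/250`, `γ = 1/2`, with `f(1) < −1` and `f(β) ≥ −1` in every dimension `≥ 2` — the
fsl-extension of the decomposition cell's certified LP optimum (table `lpCoeff0164`, `…DefsTable`).
Chain (all in the tree, leafhand lineages -1 (g0–g4) and -2 (g0)): `stub_tweakNeg0164_of_LP` (reduction of the stub to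
the two numerical inequalities (I), (II) for the table) ⟸ (I'): `J3_lower_bound_0164` (`2.5704 ≤ J₃`) with
`table_five_sum_ge_0164` (dimension-5 term `≥ 59/400`), rescaled by `λ = 49/50`; (II'): the 66 one-parameter family
inequalities of `negWitness0164_of_family_bounds` (`…CruxOfFamilies`) ⟸ the 36 families with `j₀ ≤ j₁`
(`family_<j₀>_<j₁>_le_0164`, `…FamiliesA/B/C`; symmetry `family_bounds_of_le_0164` of `…FamilySwap`) ⟸ 109 lattice
pieces (`…Link*`: exact pinned-sum evaluation `…PinnedCover*`, per-cell polynomial majorants `…Cells*`, and the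
certified piece inequalities `…PiecesF*` / `…FamilyPiece*` against `(50/49)(1 + log ρ(α))`).
This file only assembles: `mem36_0164`, `family_bounds_36_0164`, `family_bounds_66_0164`, then `stub_tweakNeg0164` (the
registered stub of skeleton `Cruxes/NegWitness0164/Lines/birth.lean`, VERBATIM) and
`negWitness0164_proof : Summit.Parity.GeneralizedHardyLittlewood.Theses.FordMaynardNoSieveConst0164.NegWitness0164`.
Closing one crux of route `FordMaynardNoSieveConst0164`; nothing here proves the Parity summit.  Standard axioms only.
-/

noncomputable section

open Finset MeasureTheory Set
open scoped Classical
open Literature.NumberTheory.Sieve Literature.NumberTheory.Sieve.FordMaynard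
open Summit.Parity.GeneralizedHardyLittlewood.FordMaynardNoSieveConst0164NegWitness0164

namespace Summit.Parity.GeneralizedHardyLittlewood.Theses.FordMaynardNoSieveConst0164

/-- The 36 admissible frozen pairs `j₀ ≤ j₁`, `j₀ + j₁ ≤ 10`. [folklore] -/
theorem mem36_0164 (a b : ℕ) (hle : a ≤ b) (hsum : a + b ≤ 10) :
    (a, b) ∈ ([(0, 0), (0, 1), (0, 2), (0, 3), (0, 4), (0, 5), (0, 6), (0, 7), (0, 8), (0, 9), (0, 10), (1, 1), (1, 2), (1, 3), (1, 4), (1, 5), (1, 6), (1, 7), (1, 8), (1, 9), (2, 2), (2, 3), (2, 4), (2, 5), (2, 6), (2, 7), (2, 8), (3, 3), (3, 4), (3, 5), (3, 6), (3, 7), (4, 4), (4, 5), (4, 6), (5, 5)] : List (ℕ × ℕ)) := by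
  have ha : a ≤ 5 := by omega
  have hb : b ≤ 10 := by omega
  interval_cases a <;> interval_cases b <;> simp_all

/-- **The 36 family inequalities (`j₀ ≤ j₁`)** in the generic form of `family_bounds_of_le_0164`.
[cite: FordMaynard2024PrimeSieves, §8 (proof of Theorem 2.7 (c))] -/
theorem family_bounds_36_0164 : ∀ j : Fin 2 → Fin 24, (j 0 : ℕ) ≤ (j 1 : ℕ) → (j 0 : ℕ) + (j 1 : ℕ) ≤ 10 →
    ∀ α : ℝ, 1 / 2 ≤ α →
      (1 : ℝ) - 2 * (41 / 250) - ((((j 0 : ℕ) + (j 1 : ℕ) : ℕ) : ℝ) + 2) * (7 / 500) ≤ α →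
      α ≤ (1 : ℝ) - 2 * (41 / 250) - (((j 0 : ℕ) + (j 1 : ℕ) : ℕ) : ℝ) * (7 / 500) →
      α / 6 * ∑ τ : Fin 3 → Fin 24, lpCoeff0164 (Fin.append τ j) * sliceIntegral 3 α (fun v : Fin 3 → ℝ =>
        if ∀ i, (41 / 250 + (τ i : ℕ) * (7 / 500) : ℝ) ≤ v i ∧ v i < 41 / 250 + ((τ i : ℕ) + 1) * (7 / 500) then
          1 / (v 0 * v 1 * v 2) else 0) ≤
      50 / 49 * (1 + (if 1 / 2 + 41 / 250 ≤ α then Real.log ((1 / 2) / (α - 1 / 2))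
        else Real.log ((α - 41 / 250) / (41 / 250)))) := by
  intro j hle hsum α _ h1 h2
  have hj : j = ![j 0, j 1] := by
    funext i; fin_cases i <;> rfl
  have hm := mem36_0164 _ _ hle hsum
  simp only [List.mem_cons, Prod.mk.injEq, List.not_mem_nil, or_false] at hm
  rcases hm with ⟨ha, hb⟩ | ⟨ha, hb⟩ | ⟨ha, hb⟩ | ⟨ha, hb⟩ | ⟨ha, hb⟩ | ⟨ha, hb⟩ | ⟨ha, hb⟩ | ⟨ha, hb⟩ | ⟨ha, hb⟩ | ⟨ha, hb⟩ | ⟨ha, hb⟩ | ⟨ha, hb⟩ | ⟨ha, hb⟩ | ⟨ha, hb⟩ | ⟨ha, hb⟩ | ⟨ha, hb⟩ | ⟨ha, hb⟩ | ⟨ha, hb⟩ | ⟨ha, hb⟩ | ⟨ha, hb⟩ | ⟨ha, hb⟩ | ⟨ha, hb⟩ | ⟨ha, hb⟩ | ⟨ha, hb⟩ | ⟨ha, hb⟩ | ⟨ha, hb⟩ | ⟨ha, hb⟩ | ⟨ha, hb⟩ | ⟨ha, hb⟩ | ⟨ha, hb⟩ | ⟨ha, hb⟩ | ⟨ha, hb⟩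 | ⟨ha, hb⟩ | ⟨ha, hb⟩ | ⟨ha, hb⟩ | ⟨ha, hb⟩
  · have h0' : j 0 = 0 := Fin.ext (ha.trans (by decide))
    have h1' : j 1 = 0 := Fin.ext (hb.trans (by decide))
    rw [ha, hb] at h1 h2
    push_cast at h1 h2
    rw [hj, h0', h1']
    exact family_0_0_le_0164 (by linarith) (by linarith)
  · have h0' : j 0 = 0 := Fin.ext (ha.trans (by decide))
    have h1' : j 1 = 1 := Fin.ext (hb.trans (by decide))
    rw [ha, hb] at h1 h2
    push_cast at h1 h2
    rw [hj, h0', h1']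
    exact family_0_1_le_0164 (by linarith) (by linarith)
  · have h0' : j 0 = 0 := Fin.ext (ha.trans (by decide))
    have h1' : j 1 = 2 := Fin.ext (hb.trans (by decide))
    rw [ha, hb] at h1 h2
    push_cast at h1 h2
    rw [hj, h0', h1']
    exact family_0_2_le_0164 (by linarith) (by linarith)
  · have h0' : j 0 = 0 := Fin.ext (ha.trans (by decide))
    have h1' : j 1 = 3 := Fin.ext (hb.trans (by decide))
    rw [ha, hb] at h1 h2
    push_cast at h1 h2
    rw [hj, h0', h1']
    exact family_0_3_le_0164 (by linarith) (by linarith)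
  · have h0' : j 0 = 0 := Fin.ext (ha.trans (by decide))
    have h1' : j 1 = 4 := Fin.ext (hb.trans (by decide))
    rw [ha, hb] at h1 h2
    push_cast at h1 h2
    rw [hj, h0', h1']
    exact family_0_4_le_0164 (by linarith) (by linarith)
  · have h0' : j 0 = 0 := Fin.ext (ha.trans (by decide))
    have h1' : j 1 = 5 := Fin.ext (hb.trans (by decide))
    rw [ha, hb] at h1 h2
    push_cast at h1 h2
    rw [hj, h0', h1']
    exact family_0_5_le_0164 (by linarith) (by linarith)
  · have h0' : j 0 = 0 := Fin.ext (ha.trans (by decide))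
    have h1' : j 1 = 6 := Fin.ext (hb.trans (by decide))
    rw [ha, hb] at h1 h2
    push_cast at h1 h2
    rw [hj, h0', h1']
    exact family_0_6_le_0164 (by linarith) (by linarith)
  · have h0' : j 0 = 0 := Fin.ext (ha.trans (by decide))
    have h1' : j 1 = 7 := Fin.ext (hb.trans (by decide))
    rw [ha, hb] at h1 h2
    push_cast at h1 h2
    rw [hj, h0', h1']
    exact family_0_7_le_0164 (by linarith) (by linarith)
  · have h0' : j 0 = 0 := Fin.ext (ha.trans (by decide))
    have h1' : j 1 = 8 := Fin.ext (hb.trans (by decide))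
    rw [ha, hb] at h1 h2
    push_cast at h1 h2
    rw [hj, h0', h1']
    exact family_0_8_le_0164 (by linarith) (by linarith)
  · have h0' : j 0 = 0 := Fin.ext (ha.trans (by decide))
    have h1' : j 1 = 9 := Fin.ext (hb.trans (by decide))
    rw [ha, hb] at h1 h2
    push_cast at h1 h2
    rw [hj, h0', h1']
    exact family_0_9_le_0164 (by linarith) (by linarith)
  · have h0' : j 0 = 0 := Fin.ext (ha.trans (by decide))
    have h1' : j 1 = 10 := Fin.ext (hb.trans (by decide))
    rw [ha, hb] at h1 h2
    push_cast at h1 h2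
    rw [hj, h0', h1']
    exact family_0_10_le_0164 (by linarith) (by linarith)
  · have h0' : j 0 = 1 := Fin.ext (ha.trans (by decide))
    have h1' : j 1 = 1 := Fin.ext (hb.trans (by decide))
    rw [ha, hb] at h1 h2
    push_cast at h1 h2
    rw [hj, h0', h1']
    exact family_1_1_le_0164 (by linarith) (by linarith)
  · have h0' : j 0 = 1 := Fin.ext (ha.trans (by decide))
    have h1' : j 1 = 2 := Fin.ext (hb.trans (by decide))
    rw [ha, hb] at h1 h2
    push_cast at h1 h2
    rw [hj, h0', h1']
    exact family_1_2_le_0164 (by linarith) (by linarith)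
  · have h0' : j 0 = 1 := Fin.ext (ha.trans (by decide))
    have h1' : j 1 = 3 := Fin.ext (hb.trans (by decide))
    rw [ha, hb] at h1 h2
    push_cast at h1 h2
    rw [hj, h0', h1']
    exact family_1_3_le_0164 (by linarith) (by linarith)
  · have h0' : j 0 = 1 := Fin.ext (ha.trans (by decide))
    have h1' : j 1 = 4 := Fin.ext (hb.trans (by decide))
    rw [ha, hb] at h1 h2
    push_cast at h1 h2
    rw [hj, h0', h1']
    exact family_1_4_le_0164 (by linarith) (by linarith)
  · have h0' : j 0 = 1 := Fin.ext (ha.trans (by decide))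
    have h1' : j 1 = 5 := Fin.ext (hb.trans (by decide))
    rw [ha, hb] at h1 h2
    push_cast at h1 h2
    rw [hj, h0', h1']
    exact family_1_5_le_0164 (by linarith) (by linarith)
  · have h0' : j 0 = 1 := Fin.ext (ha.trans (by decide))
    have h1' : j 1 = 6 := Fin.ext (hb.trans (by decide))
    rw [ha, hb] at h1 h2
    push_cast at h1 h2
    rw [hj, h0', h1']
    exact family_1_6_le_0164 (by linarith) (by linarith)
  · have h0' : j 0 = 1 := Fin.ext (ha.trans (by decide))
    have h1' : j 1 = 7 := Fin.ext (hb.trans (by decide))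
    rw [ha, hb] at h1 h2
    push_cast at h1 h2
    rw [hj, h0', h1']
    exact family_1_7_le_0164 (by linarith) (by linarith)
  · have h0' : j 0 = 1 := Fin.ext (ha.trans (by decide))
    have h1' : j 1 = 8 := Fin.ext (hb.trans (by decide))
    rw [ha, hb] at h1 h2
    push_cast at h1 h2
    rw [hj, h0', h1']
    exact family_1_8_le_0164 (by linarith) (by linarith)
  · have h0' : j 0 = 1 := Fin.ext (ha.trans (by decide))
    have h1' : j 1 = 9 := Fin.ext (hb.trans (by decide))
    rw [ha, hb] at h1 h2
    push_cast at h1 h2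
    rw [hj, h0', h1']
    exact family_1_9_le_0164 (by linarith) (by linarith)
  · have h0' : j 0 = 2 := Fin.ext (ha.trans (by decide))
    have h1' : j 1 = 2 := Fin.ext (hb.trans (by decide))
    rw [ha, hb] at h1 h2
    push_cast at h1 h2
    rw [hj, h0', h1']
    exact family_2_2_le_0164 (by linarith) (by linarith)
  · have h0' : j 0 = 2 := Fin.ext (ha.trans (by decide))
    have h1' : j 1 = 3 := Fin.ext (hb.trans (by decide))
    rw [ha, hb] at h1 h2
    push_cast at h1 h2
    rw [hj, h0', h1']
    exact family_2_3_le_0164 (by linarith) (by linarith)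
  · have h0' : j 0 = 2 := Fin.ext (ha.trans (by decide))
    have h1' : j 1 = 4 := Fin.ext (hb.trans (by decide))
    rw [ha, hb] at h1 h2
    push_cast at h1 h2
    rw [hj, h0', h1']
    exact family_2_4_le_0164 (by linarith) (by linarith)
  · have h0' : j 0 = 2 := Fin.ext (ha.trans (by decide))
    have h1' : j 1 = 5 := Fin.ext (hb.trans (by decide))
    rw [ha, hb] at h1 h2
    push_cast at h1 h2
    rw [hj, h0', h1']
    exact family_2_5_le_0164 (by linarith) (by linarith)
  · have h0' : j 0 = 2 := Fin.ext (ha.trans (by decide))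
    have h1' : j 1 = 6 := Fin.ext (hb.trans (by decide))
    rw [ha, hb] at h1 h2
    push_cast at h1 h2
    rw [hj, h0', h1']
    exact family_2_6_le_0164 (by linarith) (by linarith)
  · have h0' : j 0 = 2 := Fin.ext (ha.trans (by decide))
    have h1' : j 1 = 7 := Fin.ext (hb.trans (by decide))
    rw [ha, hb] at h1 h2
    push_cast at h1 h2
    rw [hj, h0', h1']
    exact family_2_7_le_0164 (by linarith) (by linarith)
  · have h0' : j 0 = 2 := Fin.ext (ha.trans (by decide))
    have h1' : j 1 = 8 := Fin.ext (hb.trans (by decide))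
    rw [ha, hb] at h1 h2
    push_cast at h1 h2
    rw [hj, h0', h1']
    exact family_2_8_le_0164 (by linarith) (by linarith)
  · have h0' : j 0 = 3 := Fin.ext (ha.trans (by decide))
    have h1' : j 1 = 3 := Fin.ext (hb.trans (by decide))
    rw [ha, hb] at h1 h2
    push_cast at h1 h2
    rw [hj, h0', h1']
    exact family_3_3_le_0164 (by linarith) (by linarith)
  · have h0' : j 0 = 3 := Fin.ext (ha.trans (by decide))
    have h1' : j 1 = 4 := Fin.ext (hb.trans (by decide))
    rw [ha, hb] at h1 h2
    push_cast at h1 h2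
    rw [hj, h0', h1']
    exact family_3_4_le_0164 (by linarith) (by linarith)
  · have h0' : j 0 = 3 := Fin.ext (ha.trans (by decide))
    have h1' : j 1 = 5 := Fin.ext (hb.trans (by decide))
    rw [ha, hb] at h1 h2
    push_cast at h1 h2
    rw [hj, h0', h1']
    exact family_3_5_le_0164 (by linarith) (by linarith)
  · have h0' : j 0 = 3 := Fin.ext (ha.trans (by decide))
    have h1' : j 1 = 6 := Fin.ext (hb.trans (by decide))
    rw [ha, hb] at h1 h2
    push_cast at h1 h2
    rw [hj, h0', h1']
    exact family_3_6_le_0164 (by linarith) (by linarith)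
  · have h0' : j 0 = 3 := Fin.ext (ha.trans (by decide))
    have h1' : j 1 = 7 := Fin.ext (hb.trans (by decide))
    rw [ha, hb] at h1 h2
    push_cast at h1 h2
    rw [hj, h0', h1']
    exact family_3_7_le_0164 (by linarith) (by linarith)
  · have h0' : j 0 = 4 := Fin.ext (ha.trans (by decide))
    have h1' : j 1 = 4 := Fin.ext (hb.trans (by decide))
    rw [ha, hb] at h1 h2
    push_cast at h1 h2
    rw [hj, h0', h1']
    exact family_4_4_le_0164 (by linarith) (by linarith)
  · have h0' : j 0 = 4 := Fin.ext (ha.trans (by decide))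
    have h1' : j 1 = 5 := Fin.ext (hb.trans (by decide))
    rw [ha, hb] at h1 h2
    push_cast at h1 h2
    rw [hj, h0', h1']
    exact family_4_5_le_0164 (by linarith) (by linarith)
  · have h0' : j 0 = 4 := Fin.ext (ha.trans (by decide))
    have h1' : j 1 = 6 := Fin.ext (hb.trans (by decide))
    rw [ha, hb] at h1 h2
    push_cast at h1 h2
    rw [hj, h0', h1']
    exact family_4_6_le_0164 (by linarith) (by linarith)
  · have h0' : j 0 = 5 := Fin.ext (ha.trans (by decide))
    have h1' : j 1 = 5 := Fin.ext (hb.trans (by decide))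
    rw [ha, hb] at h1 h2
    push_cast at h1 h2
    rw [hj, h0', h1']
    exact family_5_5_le_0164 (by linarith) (by linarith)
/-- **The 66 family inequalities** (hypothesis `h` of `negWitness0164_of_family_bounds`, all ordered pairs
`j₀ + j₁ ≤ 10`). [cite: FordMaynard2024PrimeSieves, §8 (proof of Theorem 2.7 (c))] -/
theorem family_bounds_66_0164 : ∀ j : Fin 2 → Fin 24, (j 0 : ℕ) + (j 1 : ℕ) ≤ 10 → ∀ α : ℝ, 1 / 2 ≤ α →
    1 - (41 / 250 + ((j 0 : ℕ) + 1) * (7 / 500)) - (41 / 250 + ((j 1 : ℕ) + 1) * (7 / 500)) ≤ α →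
    α ≤ 1 - (41 / 250 + (j 0 : ℕ) * (7 / 500)) - (41 / 250 + (j 1 : ℕ) * (7 / 500)) →
    α / 6 * ∑ τ : Fin 3 → Fin 24, lpCoeff0164 (Fin.append τ j) * sliceIntegral 3 α (fun v : Fin 3 → ℝ =>
        if ∀ i, (41 / 250 + (τ i : ℕ) * (7 / 500) : ℝ) ≤ v i ∧ v i < 41 / 250 + ((τ i : ℕ) + 1) * (7 / 500) then
          1 / (v 0 * v 1 * v 2) else 0) ≤
    50 / 49 * (1 + (if 1 / 2 + 41 / 250 ≤ α then Real.log ((1 / 2) / (α - 1 / 2))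
        else Real.log ((α - 41 / 250) / (41 / 250)))) := by
  intro j hj α h0 h1 h2
  exact family_bounds_of_le_0164
    (fun α τ => sliceIntegral 3 α (fun v : Fin 3 → ℝ =>
        if ∀ i, (41 / 250 + (τ i : ℕ) * (7 / 500) : ℝ) ≤ v i ∧ v i < 41 / 250 + ((τ i : ℕ) + 1) * (7 / 500) then
          1 / (v 0 * v 1 * v 2) else 0))
    (fun α => 50 / 49 * (1 + (if 1 / 2 + 41 / 250 ≤ α then Real.log ((1 / 2) / (α - 1 / 2))
        else Real.log ((α - 41 / 250) / (41 / 250)))))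
    (fun m : ℕ => (1 : ℝ) - 2 * (41 / 250) - ((m : ℝ) + 2) * (7 / 500))
    (fun m : ℕ => (1 : ℝ) - 2 * (41 / 250) - (m : ℝ) * (7 / 500))
    family_bounds_36_0164 j hj α h0 (by push_cast at h1 ⊢; linarith) (by push_cast at h2 ⊢; linarith)

/-- **The registered stub `stub_tweakNeg0164` of the skeleton `Cruxes/NegWitness0164/Lines/birth.lean` (VERBATIM)**:
raw symmetric piecewise-Lipschitz step data `F₀` supported on `{ξᵢ ≥ 41/250, Σξᵢ = 1}` whose fsl-extension
`tweak (1/2) (41/250) ∅ ∅ F₀` is `< −1` at `(1)` and `≥ −1` in all dimensions `≥ 2`.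
[cite: FordMaynard2024PrimeSieves, §8 (proof of Theorem 2.7 (c))] -/
theorem stub_tweakNeg0164 :
    ∃ F₀ : VecFn, F₀.IsSymmetric ∧ (∀ k, IsPiecewiseLipschitz (F₀ k)) ∧
      (∀ (k : ℕ) (ξ : Fin k → ℝ), F₀ k ξ ≠ 0 → (∀ i, (41 / 250 : ℝ) ≤ ξ i) ∧ ∑ i, ξ i = 1) ∧
      tweak (1 / 2) (41 / 250) Fin.elim0 Fin.elim0 F₀ 1 (fun _ => 1) < -1 ∧
      ∀ k : ℕ, 2 ≤ k → ∀ β : Fin k → ℝ, -1 ≤ tweak (1 / 2) (41 / 250) Fin.elim0 Fin.elim0 F₀ k β := by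
  refine stub_tweakNeg0164_of_family_bounds_scaled (49 / 50) (25704 / 10000) (by norm_num) (by norm_num)
    J3_lower_bound_0164 ?_
  intro j hj α h1 h2 h3
  have := family_bounds_66_0164 j hj α h1 h2 h3
  rw [show ((49 / 50 : ℝ))⁻¹ = 50 / 49 by norm_num]
  exact this

/-- **The route crux `NegWitness0164` (stmt-Parity-19102), by name**: `TypeIStarNegWitness (41/250) (1/2)` — some
`f ∈ 𝔉*_{41/250}(1/2)` with `f(1) < −1` and `f ≥ −1` in every dimension `≥ 2` (Ford–Maynard, Theorem 2.7 (c) at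
`ν₀ = 0.164`). [cite: FordMaynard2024PrimeSieves, Theorem 2.7 (c) / §8] -/
theorem negWitness0164_proof :
    Summit.Parity.GeneralizedHardyLittlewood.Theses.FordMaynardNoSieveConst0164.NegWitness0164 :=
  negWitness0164_of_family_bounds family_bounds_66_0164

end Summit.Parity.GeneralizedHardyLittlewood.Theses.FordMaynardNoSieveConst0164

end
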